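import Summits.BirchSwinnertonDyer.Rank1Residual.AdditivePotMult.PStarTwistModel
import Summits.BirchSwinnertonDyer.Rank1Residual.AdditivePotMult.RankOneHeegnerClass
import Summits.BirchSwinnertonDyer.Rank1Residual.Additive.X4RankZeroSemistableTwistAnyOdd
import Summits.BirchSwinnertonDyer.Rank1Residual.Additive.X3RankZeroSemistableTwistAnyOdd
import Summits.BirchSwinnertonDyer.Rank1Residual.Additive.MinusPeriodRatio
import HarnessLib

/-!
# X4(M) / X3♯(M), analytic rank `0`: the UPPER half of `BSD(E,p)` from the typed `χ_p`-branch input ALONE — no Tamagawa, no Manin, no `j`-witness (the branch side meets the field side)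

HONEST FRAMING (cell `b2b-bsdres`, run/shared/lean/b2b/bsd-rank1-residual/, verbatim in every
file): the goal of the cell is to DELETE the COMBINATION-SHAPED residual classes of the
Birch–Swinnerton-Dyer formula for ALL analytic-rank `≤ 1` elliptic curves over `ℚ` — "full BSD
formula for every rank `≤ 1` curve in class `C`" assembled STRICTLY from published theorems — so
that the rank-`≤ 1` remainder becomes exactly the CONSTRUCTION-SHAPED classes, which are TYPED
(missing-input `Prop`s), NOT attempted. This is not "finishing BSD". Sub-cell
`b2b-bsdres-additive-p1` (CLASS-OWNERS row "X3/X4 additive — pot. multiplicative / X3♯(M)"),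
generation 6; research route, no claim beyond the stated sub-classes; X3♯(M) and X4(M) REMAIN
CONSTRUCTION-SHAPED; nothing is booked.

Theorems only; no definition, no named fact. Seat additive-p4's branch-side line V9/V9b
(`X4RankZeroTwist.missingUpperBoundAt_of_odd_prime_of_surj`, `X3RankZeroTwist.…`, Delbourgo 1998
Prop. 4 = tree fact `Delbourgo1998.prop4_rankZero_pow_dvd_constantCoeff` — whose Euler
characteristic at an additive potentially multiplicative prime carries the Tamagawa numbers at
`ℓ ≠ p` and NO local factor at `p` (Delbourgo, Compositio 113 (1998), Lemma p. 139 (ii) and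
Prop. 4 p. 144) — plus the TYPED `χ_p`-branch inputs `ChiBranchLeadingTerm[Odd][BigImage]At W p`
= "[B∘C] at `T = 0`") takes as DATA a globally minimal semistable twist `V` with `W ≅ V^{(p*)}`, its
newform and two rational period ratios. For the sub-cell's classes that datum now EXISTS as a
kernel theorem (`PotMult.exists_mult_pStar_twist_model`, gen 6; newform and period ratios from a
modular parametrisation datum — Edixhoven 1991 §1, tree
`ModularParametrizationData.exists_rat_mul_realPeriodRat_eq_plusPeriod` /
`exists_rat_mul_imaginaryPeriodRat_eq_minusPeriod`), so at the CLASS level: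

* `ClassX4M.missingUpperBoundAt_rankZero_of_chiBranch` — `(E,p) ∈ X4(M)`, `r_an = 0`, `ρ̄_{E,p}`
  onto (and `ram(3)` if `p = 3`): **`Typed.MissingUpperBoundAt W p` from the typed branch input
  alone** — NO `p ∤ ∏ c_ℓ`, NO Manin-constant datum, NO `j`-witness, BOTH parities of `p`;
* `ClassX4M.bsdp_rankZero_of_chiBranch_of_shaAn_unit` — hence `BSD(E,p)` on the `p ∤ #Ш_an(E)`
  rows: this is the sub-cell's FIRST lever reaching the TAMAGAWA-OBSTRUCTED rank-zero X4(M) pairs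
  (`p ∣ c_ℓ` at a split multiplicative `ℓ ≠ p`; in the census window 9450dh1@5, 14850cm1@5 —
  out of reach of Kim 2026 (needs `p ∤ ∏c_ℓ·#Ш_an`), of the Heegner-index lever (`p ∣ I_K` forced by
  Gross–Zagier) and of Cassels–Tate parity (`ord_p ∏c_ℓ = 2`)), modulo the ONE typed input;
* `ClassX4M.missingInputAt_iff_lower_rankZero_of_chiBranch`, `…bsdp_rankZero_of_chiBranch_of_lower`
  — what then remains is EXACTLY the lower half over `ℚ`;
* `ClassX4M.bsdp_rankZero_of_jWitness_of_chiBranch_of_lowerOverC` — on the `j`-witness branch the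
  lower half is the LOWER half of the gen-2/3 over-`K'` input (Skinner 2016 Thm. C closes the
  rank-zero (ram) twist; Milne 1972): `BSD(E,p) ⇐ [B∘C]@0 ∧ MissingLowerBoundOverCAt(E_{K'})` with
  NO Tamagawa / Manin hypothesis — the branch side (additive-p4) and the field side (additive-p1)
  of the sub-cell are now ONE statement each, jointly sufficient;
* `ClassX3M.missingUpperBoundAt_rankZero_of_chiBranch` / `…bsdp…_of_shaAn_unit` — the X3♯(M) twins
  (Wuthrich 2014 Thm. 16 side; extra `p ∤ c_p(E)`, as in additive-p4's X3 statement).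

Located gap UNCHANGED and now stated uniformly for both seats: the `χ_p`-eigenspace transport
[C] `X(E/ℚ_∞) ≅ X(E♭/ℚ(μ_{p^∞}))^{(χ_p)}` (folklore, not a printed sentence; Delbourgo, J. Number
Theory 95 (2002) — acq-07933, not held — is the candidate printed source), composed with the
PRINTED ε-branch divisibility [B] (Wuthrich 2014 Thm. 16 / Thm. 3 attribution, stated for the full
cyclotomic `ℤ_p^×`-extension). Labels UNCHANGED; nothing booked.
-/

noncomputable section

open scoped Classical MatrixGroups ModularForm NumberField

open CongruenceSubgroup WeierstrassCurve NumberField Literature.NumberTheory.EllipticCurves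
  Literature.NumberTheory.EllipticCurves.ModularForms
  Literature.NumberTheory.EllipticCurves.Rank1Residual
  Literature.NumberTheory.EllipticCurves.Rank1Residual.Typed
  IsDedekindDomain Rat.HeightOneSpectrum

namespace Summit.BirchSwinnertonDyer.Rank1Residual.AdditivePotMult

open Additive

variable {W : WeierstrassCurve ℚ} [W.IsElliptic] [W.IsGloballyMinimal] {p : ℕ} [hp : Fact p.Prime]

/-! ### §1 X4(M), rank `0`: the upper half from the branch input alone -/

/-- **X4(M), `r_an = 0`, big image: `Typed.MissingUpperBoundAt W p` from the typed `χ_p`-branch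
input ALONE.** For `(E,p) ∈ X4(M)` (`W` globally minimal) with `ord_{s=1} L(E,s) = 0`, `ρ̄_{E,p}`
onto and `ram(3)` when `p = 3`: granted the typed inputs `ChiBranchLeadingTermBigImageAt W p`
(used iff `p ≡ 1 (mod 4)`) / `ChiBranchLeadingTermOddBigImageAt W p` (iff `p ≡ 3 (mod 4)`),
`ord_p #Ш(E) ≤ ord_p #Ш_an(E)`. The semistable twist datum of additive-p4's
`X4RankZeroTwist.missingUpperBoundAt_of_odd_prime_of_surj` is DISCHARGED: `V` = minimal model of
`E^{(p*)}`, multiplicative at `p` (`ClassX4M.exists_mult_pStar_twist_model`), its newform and period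
ratios from a parametrisation datum (`hmodD`). Other inputs: Delbourgo 1998 Prop. 4 (`hDel`), GZK,
modularity. NO Tamagawa, NO Manin, NO `j`-witness hypothesis. X4(M) stays CONSTRUCTION-SHAPED.
[cite: Delbourgo1998, Prop. 4 (p. 144) and Lemma (ii) (p. 139)] [cite: EdixhovenManin1991, §1] -/
theorem ClassX4M.missingUpperBoundAt_rankZero_of_chiBranch
    (hDel : Delbourgo1998.prop4_rankZero_pow_dvd_constantCoeff)
    (hGZK : rank_eq_analyticRank_of_analyticRank_le_one) (hmod : hasEntireLFunction_rat)
    (hmodD : nonempty_modularParametrizationData)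
    (hBCeven : ChiBranchLeadingTermBigImageAt W p) (hBCodd : ChiBranchLeadingTermOddBigImageAt W p)
    (hX : ClassX4M W p) (hr : W.analyticRank = 0) (hsurj : Surj W p) (hram3 : p = 3 → Ram W p) :
    MissingUpperBoundAt W p := by
  obtain ⟨V, iV, iVm, C, hV, hC⟩ := hX.exists_mult_pStar_twist_model
  haveI : NeZero (V.conductorNorm ℤ) := ⟨(V.conductorNorm_pos_holds).ne'⟩
  obtain ⟨Dm⟩ := hmodD V
  obtain ⟨ϖ, -, hϖ, -⟩ := Dm.exists_rat_mul_realPeriodRat_eq_plusPeriod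
  obtain ⟨ϖ', -, hϖ'⟩ := exists_rat_mul_imaginaryPeriodRat_eq_minusPeriod Dm
  exact X4RankZeroTwist.missingUpperBoundAt_of_odd_prime_of_surj W p hDel hGZK hmod hBCeven hBCodd
    hX.p_ne_two hr hX.1 hsurj hram3 V C hC (Or.inr hV) Dm.isNewformOf ϖ hϖ ϖ' hϖ'

/-- **X4(M), `r_an = 0`, big image, `p ∤ #Ш_an(E)`: `BSD(E,p)` from the typed `χ_p`-branch input
alone** — in particular on the TAMAGAWA-OBSTRUCTED rank-zero pairs (`p ∣ c_ℓ`, `ℓ ≠ p` split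
multiplicative), which no other lever of the cell reaches. [cite: Delbourgo1998, Prop. 4 (p. 144)] -/
theorem ClassX4M.bsdp_rankZero_of_chiBranch_of_shaAn_unit
    (hDel : Delbourgo1998.prop4_rankZero_pow_dvd_constantCoeff)
    (hGZK : rank_eq_analyticRank_of_analyticRank_le_one) (hmod : hasEntireLFunction_rat)
    (hmodD : nonempty_modularParametrizationData)
    (hBCeven : ChiBranchLeadingTermBigImageAt W p) (hBCodd : ChiBranchLeadingTermOddBigImageAt W p)
    (hX : ClassX4M W p) (hr : W.analyticRank = 0) (hsurj : Surj W p) (hram3 : p = 3 → Ram W p)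
    {q : ℚ} (hq : shaAn W = (q : ℂ)) (hv : padicValRat p q = 0) : BSDp W p := by
  obtain ⟨V, iV, iVm, C, hV, hC⟩ := hX.exists_mult_pStar_twist_model
  haveI : NeZero (V.conductorNorm ℤ) := ⟨(V.conductorNorm_pos_holds).ne'⟩
  obtain ⟨Dm⟩ := hmodD V
  obtain ⟨ϖ, -, hϖ, -⟩ := Dm.exists_rat_mul_realPeriodRat_eq_plusPeriod
  obtain ⟨ϖ', -, hϖ'⟩ := exists_rat_mul_imaginaryPeriodRat_eq_minusPeriod Dm
  exact X4RankZeroTwist.bsdp_of_odd_prime_of_surj_of_shaAn_unit W p hDel hGZK hmod hBCeven hBCodd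
    hX.p_ne_two hr hX.1 hsurj hram3 V C hC (Or.inr hV) Dm.isNewformOf ϖ hϖ ϖ' hϖ' hq hv

/-- **X4(M), `r_an = 0`, big image: what remains is EXACTLY the lower half** —
`Typed.X4.MissingInputAt W p ⟺ MissingLowerBoundAt W p`, granted the branch input.
[cite: Delbourgo1998, Prop. 4 (p. 144)] -/
theorem ClassX4M.missingInputAt_iff_lower_rankZero_of_chiBranch
    (hDel : Delbourgo1998.prop4_rankZero_pow_dvd_constantCoeff)
    (hGZK : rank_eq_analyticRank_of_analyticRank_le_one) (hmod : hasEntireLFunction_rat)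
    (hmodD : nonempty_modularParametrizationData)
    (hBCeven : ChiBranchLeadingTermBigImageAt W p) (hBCodd : ChiBranchLeadingTermOddBigImageAt W p)
    (hX : ClassX4M W p) (hr : W.analyticRank = 0) (hsurj : Surj W p) (hram3 : p = 3 → Ram W p) :
    X4.MissingInputAt W p ↔ MissingLowerBoundAt W p := by
  obtain ⟨V, iV, iVm, C, hV, hC⟩ := hX.exists_mult_pStar_twist_model
  haveI : NeZero (V.conductorNorm ℤ) := ⟨(V.conductorNorm_pos_holds).ne'⟩
  obtain ⟨Dm⟩ := hmodD V
  obtain ⟨ϖ, -, hϖ, -⟩ := Dm.exists_rat_mul_realPeriodRat_eq_plusPeriod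
  obtain ⟨ϖ', -, hϖ'⟩ := exists_rat_mul_imaginaryPeriodRat_eq_minusPeriod Dm
  exact X4RankZeroTwist.missingPPartAt_iff_lower_of_odd_prime_of_surj W p hDel hGZK hmod hBCeven
    hBCodd hX.p_ne_two hr hX.1 hsurj hram3 V C hC (Or.inr hV) Dm.isNewformOf ϖ hϖ ϖ' hϖ'

/-- **X4(M), `r_an = 0`, big image: `BSD(E,p)` from the branch input and the LOWER half over `ℚ`**
(no Tamagawa / Manin hypothesis). [cite: Delbourgo1998, Prop. 4 (p. 144)] -/
theorem ClassX4M.bsdp_rankZero_of_chiBranch_of_lower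
    (hDel : Delbourgo1998.prop4_rankZero_pow_dvd_constantCoeff)
    (hGZK : rank_eq_analyticRank_of_analyticRank_le_one) (hmod : hasEntireLFunction_rat)
    (hmodD : nonempty_modularParametrizationData)
    (hBCeven : ChiBranchLeadingTermBigImageAt W p) (hBCodd : ChiBranchLeadingTermOddBigImageAt W p)
    (hX : ClassX4M W p) (hr : W.analyticRank = 0) (hsurj : Surj W p) (hram3 : p = 3 → Ram W p)
    (hlow : MissingLowerBoundAt W p) : BSDp W p :=
  bsdp_of_missingPPartAt W p hGZK (by rw [hr]; exact zero_le_one)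
    ((ClassX4M.missingInputAt_iff_lower_rankZero_of_chiBranch hDel hGZK hmod hmodD hBCeven hBCodd hX
      hr hsurj hram3).mpr hlow)

/-! ### §2 The branch side meets the field side: X4(M) ∧ (`j`-witness), rank `0` -/

/-- **X4(M) ∧ (`j`-witness), `r_an = 0`, big image: `BSD(E,p)` from the typed `χ_p`-branch input
(upper half; additive-p4's side) and the LOWER half of the over-`K'` input of gens 2–4 (this seat's
side: `MissingLowerBoundOverCAt (E_{K'})` over the quadratic fields `K'` whose twist `E^{(d_{K'})}`
is `p`-multiplicative; the rank-zero (ram) twist is closed by Skinner 2016 Thm. C, the descent is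
Milne 1972).** NO Tamagawa hypothesis, NO Manin datum: the two residues of the sub-cell are
jointly sufficient as stated. [cite: Delbourgo1998, Prop. 4 (p. 144)]
[cite: Skinner2016PacificMC, Thm. C] [cite: Milne1972ArithmeticAV, §1 Thm. 1 and Cor.] -/
theorem ClassX4M.bsdp_rankZero_of_jWitness_of_chiBranch_of_lowerOverC
    (hDel : Delbourgo1998.prop4_rankZero_pow_dvd_constantCoeff)
    (hGZK : rank_eq_analyticRank_of_analyticRank_le_one) (hmod : hasEntireLFunction_rat)
    (hmodD : nonempty_modularParametrizationData)
    (hMilneC : Milne1972.bsdQuotient_baseChange_quadratic_anyModel)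
    (hSk : Skinner2016.thmC_padicValRat_bsd_rank_zero)
    (hnf : exists_isNewformOf) (hHL : HoffsteinLuo1997_exists_twist_L_one_ne_zero)
    (hBCeven : ChiBranchLeadingTermBigImageAt W p) (hBCodd : ChiBranchLeadingTermOddBigImageAt W p)
    (hX : ClassX4M W p) (hr : W.analyticRank = 0) (hsurj : Surj W p) (hram3 : p = 3 → Ram W p)
    {q : ℕ} (hq : q.Prime) (hqp : q ≠ p) (hjq : padicValRat q W.j < 0)
    (hpj : ¬ (p : ℤ) ∣ padicValRat q W.j)
    (hK : ∀ (K : Type) [Field K] [NumberField K] (Wd : WeierstrassCurve ℚ) [Wd.IsElliptic]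
      [Wd.IsGloballyMinimal], Module.finrank ℚ K = 2 →
      (∃ C : VariableChange ℚ, C • W.quadraticTwist (NumberField.discr K : ℚ) = Wd) →
      Mult Wd p → MissingLowerBoundOverCAt (W.baseChange K) p) :
    BSDp W p :=
  ClassX4M.bsdp_rankZero_of_chiBranch_of_lower hDel hGZK hmod hmodD hBCeven hBCodd hX hr hsurj hram3
    (missingLowerBoundAt_of_classX4M_of_jWitness_of_lowerOverC hGZK hmod hMilneC hSk hnf hHL hX
      (by rw [hr]; exact zero_le_one) hq hqp hjq hpj hK)

/-! ### §3 X3♯(M), rank `0`: the upper half from the branch input (Wuthrich Thm. 16 side) -/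

/-- **X3♯(M), `r_an = 0`: `Typed.MissingUpperBoundAt W p` from the typed `χ_p`-branch input**
(`ChiBranchLeadingTermAt` / `ChiBranchLeadingTermOddAt`, the reducible = Wuthrich 2014 Thm. 16
side of line V9) and `p ∤ c_p(E)`: the semistable twist datum of additive-p4's
`X3RankZeroTwist.missingUpperBoundAt_of_odd_prime` is DISCHARGED for every X3♯(M) pair
(`ClassX3M.exists_mult_pStar_twist_model`). X3♯(M) stays CONSTRUCTION-SHAPED.
[cite: Delbourgo1998, Prop. 4 (p. 144)] [cite: Wuthrich2014, Thm. 16 (p. 397) (shape only; nothing asserted)] -/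
theorem ClassX3M.missingUpperBoundAt_rankZero_of_chiBranch
    (hDel : Delbourgo1998.prop4_rankZero_pow_dvd_constantCoeff)
    (hGZK : rank_eq_analyticRank_of_analyticRank_le_one) (hmod : hasEntireLFunction_rat)
    (hmodD : nonempty_modularParametrizationData)
    (hBCeven : ChiBranchLeadingTermAt W p) (hBCodd : ChiBranchLeadingTermOddAt W p)
    (hX : ClassX3M W p) (hr : W.analyticRank = 0)
    (htam : ¬ p ∣ W.tamagawaNumberAt ((primesEquiv (R := 𝓞 ℚ)).symm ⟨p, hp.out⟩)) :
    MissingUpperBoundAt W p := by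
  obtain ⟨V, iV, iVm, C, hV, hC⟩ := hX.exists_mult_pStar_twist_model
  haveI : NeZero (V.conductorNorm ℤ) := ⟨(V.conductorNorm_pos_holds).ne'⟩
  obtain ⟨Dm⟩ := hmodD V
  obtain ⟨ϖ, -, hϖ, -⟩ := Dm.exists_rat_mul_realPeriodRat_eq_plusPeriod
  obtain ⟨ϖ', -, hϖ'⟩ := exists_rat_mul_imaginaryPeriodRat_eq_minusPeriod Dm
  exact X3RankZeroTwist.missingUpperBoundAt_of_odd_prime W p hDel hGZK hmod hBCeven hBCodd
    hX.p_ne_two hr hX.classX3 V C hC (Or.inr hV) Dm.isNewformOf ϖ hϖ ϖ' hϖ' htam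

/-- **X3♯(M), `r_an = 0`, `p ∤ c_p(E) · #Ш_an(E)`: `BSD(E,p)` from the typed `χ_p`-branch input.**
[cite: Delbourgo1998, Prop. 4 (p. 144)] -/
theorem ClassX3M.bsdp_rankZero_of_chiBranch_of_shaAn_unit
    (hDel : Delbourgo1998.prop4_rankZero_pow_dvd_constantCoeff)
    (hGZK : rank_eq_analyticRank_of_analyticRank_le_one) (hmod : hasEntireLFunction_rat)
    (hmodD : nonempty_modularParametrizationData)
    (hBCeven : ChiBranchLeadingTermAt W p) (hBCodd : ChiBranchLeadingTermOddAt W p)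
    (hX : ClassX3M W p) (hr : W.analyticRank = 0)
    (htam : ¬ p ∣ W.tamagawaNumberAt ((primesEquiv (R := 𝓞 ℚ)).symm ⟨p, hp.out⟩))
    {q : ℚ} (hq : shaAn W = (q : ℂ)) (hv : padicValRat p q = 0) : BSDp W p :=
  bsdp_of_missingPPartAt W p hGZK (by rw [hr]; exact zero_le_one)
    (missingPPartAt_of_upper_of_shaAn_unit W p
      (ClassX3M.missingUpperBoundAt_rankZero_of_chiBranch hDel hGZK hmod hmodD hBCeven hBCodd hX hr
        htam) hq hv)

end Summit.BirchSwinnertonDyer.Rank1Residual.AdditivePotMult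

end
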